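import Summits.AnomalousDissipation.AnomalousDissipation.Theorems.BaireTransferRobustLoudUpgradeStubSteadyCorrespondenceUhc

/-!
# Stub `stub_driftLimit` of the line `malkin-cone-group-orbits`
# (crux stmt-AnomalousDissipation-1144, lead c15, wave 3):
# closed graph of the DRIFTED steady weak formulation

A classical steady state of `NS_ν(f_c)` of ANY mean `m` is `m + W` with `W ∈ H` solving the drifted
steady weak equation `⟨F_{ν,c}(W), w⟩ + ∫ ⟪Dw(y) m, W(y)⟫ dy = 0` for every test field `w ∈ 𝒱`
(all derivatives on `w`; `⟨F_{ν,c}(W), w⟩ = Torus.nsGeneratorPairing ν f_c W w`).  This file proves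
that the drifted formulation has CLOSED GRAPH along `c_k → c` in `P_S`, `ν_k → ν`, `m_k → m` in `ℝ³`
and `W_k → W` in `H`: the undrifted part is affine in `ν`, continuous in `W`
(`continuous_nsGeneratorPairing`) and in the force (`Negative.continuous_pairing`) exactly as in
`Category.isSteadyWeakSolution_of_tendsto`, and the drift pairing is the finite sum
`∫ ⟪Dw(y) m, W(y)⟫ dy = ∑ᵢ mᵢ (W, ∂ᵢw)` (`fderiv_apply_eq_sum_partialDeriv`) of products of a
coordinate of `m` with an `L²` pairing continuous on `H` (`continuous_pairing_coe`).
-/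

-- `Summit.<Summit>.<Problem>` is the tree's mandated summit-side namespace (CONVENTIONS §2); for this
-- single-conjunct summit the two coincide, so the duplicate is deliberate.
set_option linter.dupNamespace false

noncomputable section

open scoped BigOperators Topology InnerProductSpace RealInnerProductSpace ENNReal
open Filter Set Function TopologicalSpace MeasureTheory

namespace Summit.AnomalousDissipation.AnomalousDissipation.Theorems.RobustLoudUpgrade.Category

open Literature.Analysis.FunctionSpaces Literature.Analysis.FunctionSpaces.Torus
open Literature.Analysis.FluidPDE Literature.Analysis.FluidPDE.Torus
open Summit.AnomalousDissipation.AnomalousDissipation.Theses.BaireTransfer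
open Summit.AnomalousDissipation.AnomalousDissipation.Theorems.DenseLoudDesignerForces
open Summit.AnomalousDissipation.AnomalousDissipation.Theorems.RobustLoudUpgrade.CensusInterior

/-! ## §1 The drift pairing `∫ ⟪Dw(y) m, W(y)⟫ dy` in coordinates and its continuity -/

/-- **The drift pairing in coordinates.**  For a smooth test field `w`, a drift `m ∈ ℝ³` and
`W ∈ H`: `∫ ⟪Dw(y) m, W(y)⟫ dy = ∑ᵢ mᵢ (W, ∂ᵢw)` (`Dw(y) m = ∑ᵢ mᵢ ∂ᵢw(y)`, each `⟪W, ∂ᵢw⟫`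
integrable as an `L²` field paired with a continuous one). [folklore] -/
theorem integral_inner_fderiv_apply_eq_sum_pairing
    {w : UnitAddTorus (Fin 3) → EuclideanSpace ℝ (Fin 3)} (hw : IsSmooth w)
    (m : EuclideanSpace ℝ (Fin 3)) (W : energySpace (Fin 3)) :
    ∫ y, ⟪Torus.fderiv w y m, (W.1 : UnitAddTorus (Fin 3) → EuclideanSpace ℝ (Fin 3)) y⟫_ℝ =
      ∑ i, m i * pairing W.1 (partialDeriv i w) := by
  have hw1 : IsContDiff 1 w := hw.isContDiff (by simp)
  have hpt : ∀ y, ⟪Torus.fderiv w y m, (W.1 : UnitAddTorus (Fin 3) → EuclideanSpace ℝ (Fin 3)) y⟫_ℝ =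
      ∑ i, m i * ⟪(W.1 : UnitAddTorus (Fin 3) → EuclideanSpace ℝ (Fin 3)) y, partialDeriv i w y⟫_ℝ := by
    intro y
    rw [fderiv_apply_eq_sum_partialDeriv hw1, sum_inner]
    refine Finset.sum_congr rfl fun i _ => ?_
    rw [real_inner_smul_left, real_inner_comm]
  have hint : ∀ i, Integrable (fun y =>
      ⟪(W.1 : UnitAddTorus (Fin 3) → EuclideanSpace ℝ (Fin 3)) y, partialDeriv i w y⟫_ℝ) volume :=
    fun i => integrable_inner_of_continuous ((Lp.memLp W.1).integrable one_le_two)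
      (hw.partialDeriv i).continuous
  simp_rw [hpt]
  rw [integral_finsetSum _ fun i _ => (hint i).const_mul _]
  refine Finset.sum_congr rfl fun i _ => ?_
  rw [integral_const_mul]
  rfl

/-- **Continuity of the drift pairing.**  Along `m_k → m` in `ℝ³` and `W_k → W` in `H`,
`∫ ⟪Dw(y) m_k, W_k(y)⟫ dy → ∫ ⟪Dw(y) m, W(y)⟫ dy` (finite sum of products of a coordinate of
`m_k` and the `L²` pairing `(W_k, ∂ᵢw)`, continuous on `H` by `continuous_pairing_coe`). [folklore] -/
theorem tendsto_integral_inner_fderiv_apply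
    {w : UnitAddTorus (Fin 3) → EuclideanSpace ℝ (Fin 3)} (hw : IsSmooth w)
    {mm : ℕ → EuclideanSpace ℝ (Fin 3)} {m : EuclideanSpace ℝ (Fin 3)} (hmm : Tendsto mm atTop (𝓝 m))
    {U : ℕ → energySpace (Fin 3)} {W : energySpace (Fin 3)} (hU : Tendsto U atTop (𝓝 W)) :
    Tendsto (fun k => ∫ y, ⟪Torus.fderiv w y (mm k),
        ((U k).1 : UnitAddTorus (Fin 3) → EuclideanSpace ℝ (Fin 3)) y⟫_ℝ) atTop
      (𝓝 (∫ y, ⟪Torus.fderiv w y m, (W.1 : UnitAddTorus (Fin 3) → EuclideanSpace ℝ (Fin 3)) y⟫_ℝ)) := by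
  simp_rw [integral_inner_fderiv_apply_eq_sum_pairing hw]
  refine tendsto_finsetSum _ fun i _ => ?_
  have hmi : Tendsto (fun k => mm k i) atTop (𝓝 (m i)) :=
    ((PiLp.continuous_apply 2 (fun _ : Fin 3 => ℝ) i).tendsto m).comp hmm
  exact hmi.mul (((continuous_pairing_coe ((hw.partialDeriv i).memLp 2)).tendsto W).comp hU)

/-! ## §2 The stub: closed graph of the drifted steady weak formulation -/

/-- **stub_driftLimit** (registered sub-goal, c15 wave 3).  Closed graph of the drifted steady weak
formulation along `c_k → c`, `ν_k → ν`, `m_k → m`, `W_k → W` in `H`: for a fixed test field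
`w ∈ 𝒱` the identity `⟨F_{ν,c}(W_k), w⟩ = ((f_c, w) − (f_{c_k}, w)) + (ν − ν_k)(W_k, Δw) − D_k`
(affine in `ν`; `D_k = ∫ ⟪Dw m_k, W_k⟫` the drift pairing) has left side tending to
`⟨F_{ν,c}(W), w⟩` (`continuous_nsGeneratorPairing`) and right side tending to `0 + 0 − ∫ ⟪Dw m, W⟫`
(`Negative.continuous_pairing`, `continuous_pairing_coe`, `tendsto_integral_inner_fderiv_apply`).
[folklore] -/
theorem stub_driftLimit : ∀ (S : Finset (Fin 3 → ℤ)) (x : ℕ → Coeff S) (c : Coeff S) (nu : ℕ → ℝ) (ν : ℝ)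
    (mm : ℕ → EuclideanSpace ℝ (Fin 3)) (m : EuclideanSpace ℝ (Fin 3)) (U : ℕ → energySpace (Fin 3)) (W : energySpace (Fin 3)),
    Tendsto x atTop (𝓝 c) → Tendsto nu atTop (𝓝 ν) → Tendsto mm atTop (𝓝 m) → Tendsto U atTop (𝓝 W) →
    (∀ k : ℕ, ∀ w : UnitAddTorus (Fin 3) → EuclideanSpace ℝ (Fin 3), IsSmooth w → IsDivFree w → HasZeroMean w →
      Torus.nsGeneratorPairing (nu k) (force S (x k)) (U k) w +
        ∫ y, ⟪Torus.fderiv w y (mm k), ((U k).1 : UnitAddTorus (Fin 3) → EuclideanSpace ℝ (Fin 3)) y⟫_ℝ = 0) →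
    ∀ w : UnitAddTorus (Fin 3) → EuclideanSpace ℝ (Fin 3), IsSmooth w → IsDivFree w → HasZeroMean w →
      Torus.nsGeneratorPairing ν (force S c) W w +
        ∫ y, ⟪Torus.fderiv w y m, (W.1 : UnitAddTorus (Fin 3) → EuclideanSpace ℝ (Fin 3)) y⟫_ℝ = 0 := by
  intro S x c nu ν mm m U W hxc hν hmm hU h w hw hwd hwm
  -- `P V = (V, Δw)` and `D m' V = ∫ ⟪Dw m', V⟫` on representatives
  set P : energySpace (Fin 3) → ℝ := fun V =>
    ∫ y, ⟪(V.1 : UnitAddTorus (Fin 3) → EuclideanSpace ℝ (Fin 3)) y, laplacian w y⟫_ℝ with hPdef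
  set D : EuclideanSpace ℝ (Fin 3) → energySpace (Fin 3) → ℝ := fun m' V =>
    ∫ y, ⟪Torus.fderiv w y m', (V.1 : UnitAddTorus (Fin 3) → EuclideanSpace ℝ (Fin 3)) y⟫_ℝ with hDdef
  -- left side: continuity of the tested generator in the state
  have hA : Tendsto (fun k => nsGeneratorPairing ν (force S c) (U k) w) atTop
      (𝓝 (nsGeneratorPairing ν (force S c) W w)) :=
    ((continuous_nsGeneratorPairing ν (force S c) hw).tendsto W).comp hU
  -- the affine identity
  have hB : ∀ k, nsGeneratorPairing ν (force S c) (U k) w =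
      ((∫ y, ⟪force S c y, w y⟫_ℝ) - ∫ y, ⟪force S (x k) y, w y⟫_ℝ) +
        (ν - nu k) * P (U k) - D (mm k) (U k) := fun k => by
    have hk := h k w hw hwd hwm
    unfold nsGeneratorPairing at hk ⊢
    rw [hPdef, hDdef]
    linear_combination hk
  -- right side, force term
  have hPc : Continuous fun c' : Coeff S => ∫ y, ⟪force S c' y, w y⟫_ℝ :=
    Negative.continuous_pairing S hw.continuous
  have hC₁ : Tendsto (fun k => (∫ y, ⟪force S c y, w y⟫_ℝ) - ∫ y, ⟪force S (x k) y, w y⟫_ℝ)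
      atTop (𝓝 0) := by
    have h' : Tendsto (fun k => (∫ y, ⟪force S c y, w y⟫_ℝ) - ∫ y, ⟪force S (x k) y, w y⟫_ℝ)
        atTop (𝓝 ((∫ y, ⟪force S c y, w y⟫_ℝ) - ∫ y, ⟪force S c y, w y⟫_ℝ)) :=
      tendsto_const_nhds.sub ((hPc.tendsto c).comp hxc)
    rw [sub_self] at h'
    exact h'
  -- right side, viscous term
  have hP : Tendsto (fun k => P (U k)) atTop (𝓝 (pairing W.1 (laplacian w))) :=
    ((continuous_pairing_coe (hw.laplacian.memLp 2)).tendsto W).comp hU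
  have hC₂ : Tendsto (fun k => (ν - nu k) * P (U k)) atTop (𝓝 0) := by
    have h' : Tendsto (fun k => (ν - nu k) * P (U k)) atTop
        (𝓝 ((ν - ν) * pairing W.1 (laplacian w))) :=
      (tendsto_const_nhds.sub hν).mul hP
    rw [sub_self, zero_mul] at h'
    exact h'
  -- right side, drift term
  have hC₃ : Tendsto (fun k => D (mm k) (U k)) atTop (𝓝 (D m W)) :=
    tendsto_integral_inner_fderiv_apply hw hmm hU
  have hC := (hC₁.add hC₂).sub hC₃
  rw [add_zero, zero_sub] at hC
  have hlim := tendsto_nhds_unique hA (hC.congr fun k => (hB k).symm)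
  rw [hlim]
  exact neg_add_cancel _

end Summit.AnomalousDissipation.AnomalousDissipation.Theorems.RobustLoudUpgrade.Category

end
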